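import Literature.MathematicalPhysics.QuantumFieldTheory.Balaban1983to89.B13DirichletLocalInverseLetters

/-!
# `Balaban1983to89.B13WeightedInverseLettersOnCoerciveBall` — T. Bałaban, *Propagators for lattice gauge theories in a background field*, Commun. Math. Phys.
# **99** (1985) 389–434 [Balaban1985BackgroundPropagators], p. 393 (the scalar products of site ∕ bond ∕ BLOCK functions, the block one weighted by the block
# volumes), (3.79) p. 406, (3.87) p. 409 (`C_□ = (Q′G′_□²Q′*)⁻¹`), Thm 3.4 p. 400, (3.84)–(3.86) p. 407, Thm 3.10 (3.107)–(3.108) p. 416, Thm 3.11 p. 416;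
# [Balaban1984PropagatorsII] (2.69) p. 235 (the weight `(Lʲ)^{d+1}` of a `j`-block), Lemma 2.1 (2.61) p. 234; [Balaban1988RG2Cluster] (2.5)–(2.7) pp. 12–13, p. 15;
# [AizenmanWarzel2015] §10.3 (Combes–Thomas):
# ★★ MODULE 84's INVERSE LETTERS ON THE WHOLE COERCIVITY BALL, READ IN A WEIGHTED PAIRING, AND UNDER A 0∕1 DIRICHLET COMPRESSION — the generic analytic step of
# the `C_□`-station of the local-cube road (dag-n10-w3 g5's design I.38011; lane fan-out I.38258: L2 = this seat).

[folklore] bookkeeping over cited tree theorems (the lane's 83∕84 BY NAME, dag-n10-w3 g5's L1 compression algebra BY NAME); THEOREMS ONLY (no `def`, no `structure`, no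
instance, no notation); nothing of NODE 00's ∕ N06's is modified or restated; nothing here is a claim about the Yang–Mills mass gap; no node is discharged; count-neutral.

WHY THIS FILE (cell `pub-ymgap`, HUMAN RULING D-0062, Track A node N10 = [B13]; seat `pub-ymgap-dag-n10-w5` g4, width seat, station L2 of the local-cube road).  Module 84
(`B13InverseLettersOnCoerciveBall.rawEntryLetters_ringInverse_of_coer_centre_letters`) inverts a holomorphic operator family on the whole ball where the centre's
coercivity persists — with the coercivity stated in the FLAT trace pairing `⟨·,·⟩₁`.  Print's BLOCK operators (`Q′G′²Q′*`, its local version `Q′G′_□²Q′*` and their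
inverses `C`, `C_□`) are symmetric and positive for the BLOCK-VOLUME pairing `⟨g,g′⟩_W = Σ_y W(y)·tr g(y)ᴴg′(y)`, `W(y) = (Lʲ)^{d+1}` ([Balaban1984PropagatorsII] (2.69)),
not for the flat one.  This file reads module 84 in ANY weighted pairing `⟨·,·⟩_w` by conjugating the family with the multiplication `M_{√w}` (a diagonal sandwich on the
product-basis matrices, numerals `√w ≤ c_u`, `1∕√w ≤ c_l`), and then under a 0∕1 Dirichlet compression `T ↦ M_χ T M_χ + 1 − M_χ` with the centre's coercivity asked of
the COMPRESSION only (L1's `trIP_dirPadY_cutMulY_ge` is the special case of a globally coercive `T`; the local `X_□` is coercive on the cube's blocks only).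

WHAT THIS FILE PROVES (all `theorem`s; `B′` = the product basis of matrix units over `S`).
* §1 `trIP_eq_trIP_one_cutMulY` (`⟨Φ,Ψ⟩_w = ⟨Φ, M_wΨ⟩₁`), ★ `coer_one_conj_of_coer_weighted` (`m`-coercive for `⟨·,·⟩_w` ⟹ `M_{√w}TM_{1∕√w}` is `m`-coercive for `⟨·,·⟩₁`),
  `ringInverse_conj` (`(a x b)⁻¹ = a x⁻¹ b` for a two-sided invertible pair), ★★ `rawEntryLetters_ringInverse_of_coer_centre_letters_weighted`: module 84 §1 with the centre
  `m·⟨Ψ,Ψ⟩_w ≤ ⟨Ψ,T(0)Ψ⟩_w`; letters `(R, ρ, B)` ⟹ `RawEntryLetters (u ↦ toMatrix B′ B′ (T u)⁻¹) loc R′ κ (c_l·c_u·4∕m′)`, `m′ = m − 2·((c_u c_l B)·(m_F c₀(1,ρ)^ν))·R′∕R`.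
* §2 ★★ `rawEntryLetters_toMatrix_dirInvY_of_coer_compression_letters_weighted`: for a 0∕1 cut `χ`, letters `(R, ρ, B)` of `X` and the centre's coercivity of the PADDED
  COMPRESSION `m·⟨Ψ,Ψ⟩_w ≤ ⟨Ψ,(M_χX(0)M_χ + 1 − M_χ)Ψ⟩_w` ⟹ `RawEntryLetters (u ↦ toMatrix B′ B′ (dirInvY (M_χ) (X u))) loc R′ κ (c_l·c_u·4∕m′)` with `B ↦ B + 1` in the
  window (L1's `rawEntryLetters_toMatrix_dirPadY` ∕ `…_dirInvY_of_ringInverse` + §1).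
HONEST FRAMING: [folklore] conjugation ∕ compression bookkeeping; the letters and the centre's coercivity are DISPLAYED; finite-lattice constants, not print's `O(1)`; print's
multi-scale rate NOT claimed; nothing of Bałaban's asserted beyond the cited theorems; N06 ∕ N10 NOT discharged; K1⁹ NOT closed; counts unmoved (typed 28∕28 · discharged
5∕27); 0 `def`, 0 `sorry`, standard axioms; one finite 𝕋⁴ programme at fixed ε — R4 closes the conditional finite-𝕋⁴ rung `BalabanLadder.UV` only; the YM mass gap (Clay)
is NOT proved by any of this; nothing continuum ∕ ℝ⁴ ∕ OS.  Filed `--kind proof --supports` K1⁹ (stmt-QuantumFields-27364), Literature lane.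
-/

noncomputable section

namespace Literature.MathematicalPhysics.QuantumFieldTheory.Balaban1983to89.B13WeightedInverseLettersOnCoerciveBall

open Metric Set Finset Module
open scoped Matrix Matrix.Norms.L2Operator
open Literature.MathematicalPhysics.QuantumFieldTheory.Balaban1983to89
open Literature.MathematicalPhysics.QuantumFieldTheory.Balaban1983to89.B9Thm37GlueTorus (tdist1)
open Literature.MathematicalPhysics.QuantumFieldTheory.Balaban1983to89.B5TorusCover (UT)
open Literature.MathematicalPhysics.QuantumFieldTheory.Balaban1983to89.B9Thm311ReadingCoords (trIP)
open Literature.MathematicalPhysics.QuantumFieldTheory.Balaban1983to89.B13EntrywiseWalks (RawEntryLetters)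
open Literature.MathematicalPhysics.QuantumFieldTheory.Balaban1983to89.B13EntryLetterAlgebra
  (rawEntryLetters_mono rawEntryLetters_congr rawEntryLetters_sandwich range_diagonal rowsum_diagonal colsum_diagonal)
open Literature.MathematicalPhysics.QuantumFieldTheory.Balaban1983to89.B9Thm37CubeCoverCommutators (cutMulY cutMulY_apply cutMulY_mul cutMulY_one)
open Literature.MathematicalPhysics.QuantumFieldTheory.Balaban1983to89.B13InverseLettersOnCoerciveBall (rawEntryLetters_ringInverse_of_coer_centre_letters)
open Literature.MathematicalPhysics.QuantumFieldTheory.Balaban1983to89.B13DirichletLocalInverseLetters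
  (toMatrix_cutMulY rawEntryLetters_toMatrix_dirPadY rawEntryLetters_toMatrix_dirInvY_of_ringInverse)
open Literature.MathematicalPhysics.QuantumFieldTheory.Balaban1983to89.B9Thm311PosViaLocalInversesY (trIP_cutMulY_right_gen trIP_cutMulY_cutMulY)
open Literature.MathematicalPhysics.QuantumFieldTheory.Balaban1983to89.Node00.OpsYLocalInverse (dirPadY dirInvY)

/-! ## §1. Module 84 §1 read in a weighted pairing: conjugation by the square root of the weight -/

section Weighted

variable {S : Type} [Fintype S] [DecidableEq S] {N : ℕ}
variable {ν : ℕ} {Nf : Fin ν → ℕ} [∀ j, NeZero (Nf j)]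
variable {E : Type*} [NormedAddCommGroup E] [NormedSpace ℂ E]

omit [DecidableEq S] in
/-- the weighted trace pairing is the flat pairing against the weight multiplication: `⟨Φ,Ψ⟩_w = ⟨Φ, M_w Ψ⟩₁`. [folklore]
[cite: Balaban1985BackgroundPropagators, p.393 (scalar products), dictionary] -/
theorem trIP_eq_trIP_one_cutMulY (w : S → ℝ) (Φ Ψ : S → Matrix (Fin N) (Fin N) ℂ) :
    trIP w Φ Ψ = trIP (fun _ => (1 : ℝ)) Φ (cutMulY w Ψ) := by
  unfold trIP
  refine Finset.sum_congr rfl fun s _ => ?_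
  rw [one_mul, Finset.mul_sum]
  refine Finset.sum_congr rfl fun a _ => ?_
  rw [Finset.mul_sum]
  refine Finset.sum_congr rfl fun b _ => ?_
  rw [cutMulY_apply, Matrix.smul_apply, smul_eq_mul, mul_left_comm, Complex.re_ofReal_mul]

omit [DecidableEq S] in
/-- ★ **A WEIGHTED-COERCIVE OPERATOR CONJUGATED BY THE SQUARE ROOT OF THE WEIGHT IS FLAT-COERCIVE WITH THE SAME CONSTANT**:
`m·⟨Ψ,Ψ⟩_w ≤ ⟨Ψ,TΨ⟩_w` for all `Ψ` ⟹ `m·⟨Ψ,Ψ⟩₁ ≤ ⟨Ψ, M_{√w} T M_{1∕√w} Ψ⟩₁` for all `Ψ`. [folklore]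
[cite: Balaban1985BackgroundPropagators, p.393 (scalar products), Thm 3.11 p.416; Balaban1984PropagatorsII, p.226, bookkeeping] -/
theorem coer_one_conj_of_coer_weighted {w : S → ℝ} (hw : ∀ s, 0 < w s) (T : Module.End ℂ (S → Matrix (Fin N) (Fin N) ℂ)) {m : ℝ}
    (hco : ∀ Ψ : S → Matrix (Fin N) (Fin N) ℂ, m * trIP w Ψ Ψ ≤ trIP w Ψ (T Ψ)) (Ψ : S → Matrix (Fin N) (Fin N) ℂ) :
    m * trIP (fun _ => (1 : ℝ)) Ψ Ψ ≤
      trIP (fun _ => (1 : ℝ)) Ψ ((cutMulY (fun s => Real.sqrt (w s)) * T * cutMulY (fun s => (Real.sqrt (w s))⁻¹) :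
        Module.End ℂ (S → Matrix (Fin N) (Fin N) ℂ)) Ψ) := by
  set ξ : S → Matrix (Fin N) (Fin N) ℂ := cutMulY (fun s => (Real.sqrt (w s))⁻¹) Ψ with hξ
  have hc2 : (fun s => Real.sqrt (w s) * Real.sqrt (w s)) = w := funext fun s => Real.mul_self_sqrt (hw s).le
  have hcc : (fun s => Real.sqrt (w s) * (Real.sqrt (w s))⁻¹) = fun _ => (1 : ℝ) :=
    funext fun s => mul_inv_cancel₀ (Real.sqrt_pos.2 (hw s)).ne'
  -- `M_{√w} ξ = Ψ`
  have hΨ : cutMulY (fun s => Real.sqrt (w s)) ξ = Ψ := by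
    rw [hξ, ← Module.End.mul_apply, cutMulY_mul, hcc, cutMulY_one, Module.End.one_apply]
  -- the two flat quantities are the weighted ones at `ξ`
  have h1 : trIP (fun _ => (1 : ℝ)) Ψ Ψ = trIP w ξ ξ := by
    conv_lhs => rw [← hΨ]
    rw [trIP_cutMulY_cutMulY, hc2, ← trIP_eq_trIP_one_cutMulY]
  have h2 : trIP (fun _ => (1 : ℝ)) Ψ ((cutMulY (fun s => Real.sqrt (w s)) * T * cutMulY (fun s => (Real.sqrt (w s))⁻¹) :
      Module.End ℂ (S → Matrix (Fin N) (Fin N) ℂ)) Ψ) = trIP w ξ (T ξ) := by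
    have hcw : cutMulY (fun s => Real.sqrt (w s)) (cutMulY (fun s => Real.sqrt (w s)) ξ) = cutMulY w ξ := by
      rw [← Module.End.mul_apply, cutMulY_mul, hc2]
    rw [Module.End.mul_apply, Module.End.mul_apply, ← hξ, trIP_cutMulY_right_gen]
    conv_lhs => rw [← hΨ]
    rw [hcw, ← trIP_cutMulY_right_gen, ← trIP_eq_trIP_one_cutMulY]
  rw [h1, h2]
  exact hco ξ

/-- conjugating by a two-sided invertible pair commutes with `Ring.inverse`: `(a·x·b)⁻¹ = a·x⁻¹·b` when `a·b = 1 = b·a` (both sides `0` off the units).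
[folklore] [cite: Balaban1985BackgroundPropagators, (3.79) p.406, bookkeeping] -/
theorem ringInverse_conj {A : Type} [Ring A] {a b : A} (hab : a * b = 1) (hba : b * a = 1) (x : A) :
    Ring.inverse (a * x * b) = a * Ring.inverse x * b := by
  let ua : Aˣ := ⟨a, b, hab, hba⟩
  by_cases hx : IsUnit x
  · obtain ⟨u, rfl⟩ := hx
    have e : (a * (u : A) * b) = ((ua * u * ua⁻¹ : Aˣ) : A) := by simp [ua]
    rw [e, Ring.inverse_unit, Ring.inverse_unit]
    simp [ua, mul_assoc]
  · have hx' : ¬ IsUnit (a * x * b) := by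
      intro h
      apply hx
      have e : b * (a * x * b) * a = x := by
        calc b * (a * x * b) * a = (b * a) * x * (b * a) := by noncomm_ring
          _ = x := by rw [hba, one_mul, mul_one]
      rw [← e]
      have hb : IsUnit b := ⟨ua⁻¹, rfl⟩
      have ha : IsUnit a := ⟨ua, rfl⟩
      exact (hb.mul h).mul ha
    rw [Ring.inverse_non_unit _ hx, Ring.inverse_non_unit _ hx', mul_zero, zero_mul]

/-- ★★ **THE INVERSE's ENTRY LETTERS ON THE WHOLE COERCIVITY BALL — WEIGHTED-PAIRING CENTRE.**  Module 84's `rawEntryLetters_ringInverse_of_coer_centre_letters`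
with the centre's coercivity stated in a WEIGHTED trace pairing `⟨·,·⟩_w` (`0 < w`; numerals `√w ≤ c_u`, `1∕√w ≤ c_l`): for `T : E → Module.End ℂ (S → M_N(ℂ))` with
product-basis letters `(R, ρ, B)` (`0 < ρ`), fibre bound `m_F`, centre `m·⟨Ψ,Ψ⟩_w ≤ ⟨Ψ, T(0)Ψ⟩_w`, radii `0 ≤ R′ ≤ R` with margin
`m′ = m − 2·((c_u c_l B)·(m_F·c₀(1,ρ)^ν))·R′∕R > 0` and a Combes–Thomas rate `0 ≤ κ ≤ ρ∕4`, `8·(c_u c_l B)·κ·(m_F·c₀(1,ρ∕2)^ν) ≤ m′·ρ`: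
`RawEntryLetters (u ↦ toMatrix B′ B′ (Ring.inverse (T u))) loc R′ κ (c_l·c_u·(4∕m′))` — module 84 applied to the conjugated family `M_{√w}·T(u)·M_{1∕√w}` (flat-coercive
centre with the same `m`, letters `(R, ρ, c_u c_l B)` by the diagonal sandwich), the conjugation undone on the inverse.
[cite: Balaban1985BackgroundPropagators, Thm 3.4 p.400, (3.84)–(3.86) p.407, Thm 3.10 (3.108) p.416, Thm 3.11 p.416; Balaban1988RG2Cluster, (2.5)–(2.7) pp.12–13, p.15;
Balaban1984PropagatorsII, Lemma 2.1 (2.61) p.234, (2.69) p.235; AizenmanWarzel2015, §10.3] -/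
theorem rawEntryLetters_ringInverse_of_coer_centre_letters_weighted (T : E → Module.End ℂ (S → Matrix (Fin N) (Fin N) ℂ))
    {loc : S × (Fin N × Fin N) → UT Nf} {R R' ρ B m : ℝ}
    (hA : RawEntryLetters (fun u => LinearMap.toMatrix
        ((Pi.basis fun _ : S => Matrix.stdBasis ℂ (Fin N) (Fin N)).reindex (Equiv.sigmaEquivProd S (Fin N × Fin N)))
        ((Pi.basis fun _ : S => Matrix.stdBasis ℂ (Fin N) (Fin N)).reindex (Equiv.sigmaEquivProd S (Fin N × Fin N))) (T u)) loc R ρ B)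
    (hρ : 0 < ρ) {mF : ℕ} (hfib : ∀ y : UT Nf, (univ.filter fun k => loc k = y).card ≤ mF)
    {w : S → ℝ} (hw : ∀ s, 0 < w s) {cu cl : ℝ} (hcu0 : 0 ≤ cu) (hcl0 : 0 ≤ cl)
    (hcu : ∀ s, Real.sqrt (w s) ≤ cu) (hcl : ∀ s, (Real.sqrt (w s))⁻¹ ≤ cl)
    (hco : ∀ Ψ : S → Matrix (Fin N) (Fin N) ℂ, m * trIP w Ψ Ψ ≤ trIP w Ψ (T 0 Ψ))
    (hR' : 0 ≤ R') (hR'R : R' ≤ R) (hmarg : 0 < m - 2 * ((cu * cl * B) * (mF * B6.c0 1 ρ ^ ν)) * R' / R)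
    {κ : ℝ} (hκ : 0 ≤ κ) (hκ4 : κ ≤ ρ / 4)
    (hκm : 8 * (cu * cl * B) * κ * (mF * B6.c0 1 (ρ / 2) ^ ν) ≤ (m - 2 * ((cu * cl * B) * (mF * B6.c0 1 ρ ^ ν)) * R' / R) * ρ) :
    RawEntryLetters (fun u => LinearMap.toMatrix
        ((Pi.basis fun _ : S => Matrix.stdBasis ℂ (Fin N) (Fin N)).reindex (Equiv.sigmaEquivProd S (Fin N × Fin N)))
        ((Pi.basis fun _ : S => Matrix.stdBasis ℂ (Fin N) (Fin N)).reindex (Equiv.sigmaEquivProd S (Fin N × Fin N))) (Ring.inverse (T u))) loc R'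
      κ (cl * cu * (4 / (m - 2 * ((cu * cl * B) * (mF * B6.c0 1 ρ ^ ν)) * R' / R))) := by
  -- the square root of the weight and its inverse
  have hc0 : ∀ s, 0 < Real.sqrt (w s) := fun s => Real.sqrt_pos.2 (hw s)
  have hcc : (fun s => Real.sqrt (w s) * (Real.sqrt (w s))⁻¹) = fun _ => (1 : ℝ) := funext fun s => mul_inv_cancel₀ (hc0 s).ne'
  have hcc' : (fun s => (Real.sqrt (w s))⁻¹ * Real.sqrt (w s)) = fun _ => (1 : ℝ) := funext fun s => inv_mul_cancel₀ (hc0 s).ne'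
  have hab : (cutMulY (fun s => Real.sqrt (w s)) : Module.End ℂ (S → Matrix (Fin N) (Fin N) ℂ)) * cutMulY (fun s => (Real.sqrt (w s))⁻¹) = 1 := by
    rw [cutMulY_mul, hcc, cutMulY_one]
  have hba : (cutMulY (fun s => (Real.sqrt (w s))⁻¹) : Module.End ℂ (S → Matrix (Fin N) (Fin N) ℂ)) * cutMulY (fun s => Real.sqrt (w s)) = 1 := by
    rw [cutMulY_mul, hcc', cutMulY_one]
  have hnc : ∀ p : S × (Fin N × Fin N), ‖((Real.sqrt (w p.1) : ℝ) : ℂ)‖ ≤ cu := fun p => by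
    rw [Complex.norm_real, Real.norm_eq_abs, abs_of_pos (hc0 _)]; exact hcu _
  have hnci : ∀ p : S × (Fin N × Fin N), ‖(((Real.sqrt (w p.1))⁻¹ : ℝ) : ℂ)‖ ≤ cl := fun p => by
    rw [Complex.norm_real, Real.norm_eq_abs, abs_of_pos (inv_pos.2 (hc0 _))]; exact hcl _
  -- the conjugated family carries the letters `(R, ρ, c_u c_l B)` (diagonal sandwich, range 0)
  have hAc : RawEntryLetters (fun u => LinearMap.toMatrix
        ((Pi.basis fun _ : S => Matrix.stdBasis ℂ (Fin N) (Fin N)).reindex (Equiv.sigmaEquivProd S (Fin N × Fin N)))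
        ((Pi.basis fun _ : S => Matrix.stdBasis ℂ (Fin N) (Fin N)).reindex (Equiv.sigmaEquivProd S (Fin N × Fin N)))
        ((cutMulY (fun s => Real.sqrt (w s)) * T u * cutMulY (fun s => (Real.sqrt (w s))⁻¹) :
          Module.End ℂ (S → Matrix (Fin N) (Fin N) ℂ)))) loc R ρ (cu * cl * B) := by
    have hs := rawEntryLetters_sandwich (locp := loc) hA hρ.le
      (A := Matrix.diagonal fun p : S × (Fin N × Fin N) => ((Real.sqrt (w p.1) : ℝ) : ℂ))
      (B' := Matrix.diagonal fun p : S × (Fin N × Fin N) => (((Real.sqrt (w p.1))⁻¹ : ℝ) : ℂ)) (r := 0) hcu0 hcl0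
      (range_diagonal loc _) (fun p => (rowsum_diagonal _ p).le.trans (hnc p))
      (range_diagonal loc _) (fun p => (colsum_diagonal _ p).le.trans (hnci p))
    refine rawEntryLetters_mono (rawEntryLetters_congr hs fun u _ => ?_) le_rfl le_rfl (le_of_eq (by simp))
    rw [LinearMap.toMatrix_mul, LinearMap.toMatrix_mul, toMatrix_cutMulY, toMatrix_cutMulY]
  -- its centre is flat-coercive with the same constant
  have hcoc : ∀ Ψ : S → Matrix (Fin N) (Fin N) ℂ, m * trIP (fun _ => (1 : ℝ)) Ψ Ψ ≤ trIP (fun _ => (1 : ℝ)) Ψ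
      ((cutMulY (fun s => Real.sqrt (w s)) * T 0 * cutMulY (fun s => (Real.sqrt (w s))⁻¹) :
        Module.End ℂ (S → Matrix (Fin N) (Fin N) ℂ)) Ψ) :=
    fun Ψ => coer_one_conj_of_coer_weighted hw (T 0) hco Ψ
  -- module 84 on the conjugated family
  have h84 := rawEntryLetters_ringInverse_of_coer_centre_letters
    (fun u => (cutMulY (fun s => Real.sqrt (w s)) * T u * cutMulY (fun s => (Real.sqrt (w s))⁻¹) :
      Module.End ℂ (S → Matrix (Fin N) (Fin N) ℂ))) hAc hρ hfib hcoc hR' hR'R hmarg hκ hκ4 hκm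
  -- undo the conjugation on the inverse
  have hinv : ∀ u, Ring.inverse (T u) = cutMulY (fun s => (Real.sqrt (w s))⁻¹) *
      Ring.inverse ((cutMulY (fun s => Real.sqrt (w s)) * T u * cutMulY (fun s => (Real.sqrt (w s))⁻¹) :
        Module.End ℂ (S → Matrix (Fin N) (Fin N) ℂ))) * cutMulY (fun s => Real.sqrt (w s)) := by
    intro u
    rw [ringInverse_conj hab hba, ← mul_assoc, ← mul_assoc, hba, one_mul, mul_assoc, hba, mul_one]
  have hs := rawEntryLetters_sandwich (locp := loc) h84 hκ
    (A := Matrix.diagonal fun p : S × (Fin N × Fin N) => (((Real.sqrt (w p.1))⁻¹ : ℝ) : ℂ))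
    (B' := Matrix.diagonal fun p : S × (Fin N × Fin N) => ((Real.sqrt (w p.1) : ℝ) : ℂ)) (r := 0) hcl0 hcu0
    (range_diagonal loc _) (fun p => (rowsum_diagonal _ p).le.trans (hnci p))
    (range_diagonal loc _) (fun p => (colsum_diagonal _ p).le.trans (hnc p))
  refine rawEntryLetters_mono (rawEntryLetters_congr hs fun u _ => ?_) le_rfl le_rfl (le_of_eq (by simp))
  rw [hinv u, LinearMap.toMatrix_mul, LinearMap.toMatrix_mul, toMatrix_cutMulY, toMatrix_cutMulY]

end Weighted

/-! ## §2. ★★ The compressed inverse `dirInvY (M_χ) (X(u)) = M_χ·(M_χ X(u) M_χ + 1 − M_χ)⁻¹·M_χ` along a holomorphic family, weighted-pairing centre -/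

section LocalInverse

variable {S : Type} [Fintype S] [DecidableEq S] {N : ℕ}
variable {ν : ℕ} {Nf : Fin ν → ℕ} [∀ j, NeZero (Nf j)]
variable {E : Type*} [NormedAddCommGroup E] [NormedSpace ℂ E]

/-- ★★ **THE COMPRESSED-INVERSE STATION (generic).**  Let `X : E → Module.End ℂ (S → M_N(ℂ))` carry product-basis letters `(R, ρ, B)` (`0 < ρ`), `χ` a real 0∕1 cut-off,
`w > 0` a weight with numerals `√w ≤ c_u`, `1∕√w ≤ c_l`, and let the PADDED COMPRESSION at the centre be coercive: `m·⟨Ψ,Ψ⟩_w ≤ ⟨Ψ, (M_χ X(0) M_χ + 1 − M_χ)Ψ⟩_w`.  With a fibre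
bound `m_F`, radii `0 ≤ R′ ≤ R`, margin `m′ = m − 2·((c_u c_l (B+1))·(m_F·c₀(1,ρ)^ν))·R′∕R > 0` and a rate `0 ≤ κ ≤ ρ∕4`, `8·(c_u c_l (B+1))·κ·(m_F·c₀(1,ρ∕2)^ν) ≤ m′·ρ`:
`RawEntryLetters (u ↦ toMatrix B′ B′ (dirInvY (M_χ) (X u))) loc R′ κ (c_l·c_u·(4∕m′))` — the padded compression has letters `(R, ρ, B + 1)` (diagonal sandwich + the
constant diagonal `1 − χ`), §1 inverts it on the ball, the outer `M_χ`-sandwich keeps the letters.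
[cite: Balaban1985BackgroundPropagators, (3.79) p.406, (3.87) p.409 (C_□ = (Q′G′_□²Q′*)⁻¹, G_□), Thm 3.4 p.400, Thm 3.10 (3.108) p.416, Thm 3.11 p.416;
Balaban1988RG2Cluster, (2.5)–(2.7) pp.12–13, p.15; Balaban1984PropagatorsII, Lemma 2.1 (2.61) p.234; AizenmanWarzel2015, §10.3] -/
theorem rawEntryLetters_toMatrix_dirInvY_of_coer_compression_letters_weighted (X : E → Module.End ℂ (S → Matrix (Fin N) (Fin N) ℂ))
    {χ : S → ℝ} (hχ : ∀ z, χ z = 0 ∨ χ z = 1)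
    {loc : S × (Fin N × Fin N) → UT Nf} {R R' ρ B m : ℝ}
    (hX : RawEntryLetters (fun u => LinearMap.toMatrix
        ((Pi.basis fun _ : S => Matrix.stdBasis ℂ (Fin N) (Fin N)).reindex (Equiv.sigmaEquivProd S (Fin N × Fin N)))
        ((Pi.basis fun _ : S => Matrix.stdBasis ℂ (Fin N) (Fin N)).reindex (Equiv.sigmaEquivProd S (Fin N × Fin N))) (X u)) loc R ρ B)
    (hρ : 0 < ρ) {mF : ℕ} (hfib : ∀ y : UT Nf, (univ.filter fun k => loc k = y).card ≤ mF)
    {w : S → ℝ} (hw : ∀ s, 0 < w s) {cu cl : ℝ} (hcu0 : 0 ≤ cu) (hcl0 : 0 ≤ cl)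
    (hcu : ∀ s, Real.sqrt (w s) ≤ cu) (hcl : ∀ s, (Real.sqrt (w s))⁻¹ ≤ cl)
    (hco : ∀ Ψ : S → Matrix (Fin N) (Fin N) ℂ, m * trIP w Ψ Ψ ≤ trIP w Ψ (dirPadY (cutMulY χ) (X 0) Ψ))
    (hR' : 0 ≤ R') (hR'R : R' ≤ R) (hmarg : 0 < m - 2 * ((cu * cl * (B + 1)) * (mF * B6.c0 1 ρ ^ ν)) * R' / R)
    {κ : ℝ} (hκ : 0 ≤ κ) (hκ4 : κ ≤ ρ / 4)
    (hκm : 8 * (cu * cl * (B + 1)) * κ * (mF * B6.c0 1 (ρ / 2) ^ ν) ≤ (m - 2 * ((cu * cl * (B + 1)) * (mF * B6.c0 1 ρ ^ ν)) * R' / R) * ρ) :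
    RawEntryLetters (fun u => LinearMap.toMatrix
        ((Pi.basis fun _ : S => Matrix.stdBasis ℂ (Fin N) (Fin N)).reindex (Equiv.sigmaEquivProd S (Fin N × Fin N)))
        ((Pi.basis fun _ : S => Matrix.stdBasis ℂ (Fin N) (Fin N)).reindex (Equiv.sigmaEquivProd S (Fin N × Fin N))) (dirInvY (cutMulY χ) (X u))) loc R'
      κ (cl * cu * (4 / (m - 2 * ((cu * cl * (B + 1)) * (mF * B6.c0 1 ρ ^ ν)) * R' / R))) := by
  -- the padded compression `M_χ X(u) M_χ + (1 − M_χ)` carries the letters `(R, ρ, B + 1)` (L1 §1)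
  have hpad := rawEntryLetters_toMatrix_dirPadY hX hρ.le hχ
  -- §1 inverts it on the ball
  have hinv : RawEntryLetters (fun u => LinearMap.toMatrix
        ((Pi.basis fun _ : S => Matrix.stdBasis ℂ (Fin N) (Fin N)).reindex (Equiv.sigmaEquivProd S (Fin N × Fin N)))
        ((Pi.basis fun _ : S => Matrix.stdBasis ℂ (Fin N) (Fin N)).reindex (Equiv.sigmaEquivProd S (Fin N × Fin N)))
        (Ring.inverse (dirPadY (cutMulY χ) (X u)))) loc R' κ (cl * cu * (4 / (m - 2 * ((cu * cl * (B + 1)) * (mF * B6.c0 1 ρ ^ ν)) * R' / R))) :=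
    rawEntryLetters_ringInverse_of_coer_centre_letters_weighted (S := S) (N := N) (E := E) (loc := loc) (R := R) (R' := R') (ρ := ρ) (B := B + 1)
      (m := m) (w := w) (mF := mF) (κ := κ) (cu := cu) (cl := cl) (fun u => dirPadY (cutMulY χ) (X u)) hpad hρ hfib hw hcu0 hcl0 hcu hcl
      hco hR' hR'R hmarg hκ hκ4 hκm
  -- the outer `M_χ`-sandwich (L1 §1)
  exact rawEntryLetters_toMatrix_dirInvY_of_ringInverse hχ hinv hκ

end LocalInverse

end Literature.MathematicalPhysics.QuantumFieldTheory.Balaban1983to89.B13WeightedInverseLettersOnCoerciveBall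

end
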